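import Summits.NavierStokesRegularity.FluidComputer.PalasekTowerGermHostFarFieldSign

/-!
# The germ host, X: a FLAT symmetric carrier with a FORWARD-CONE orthogonal pusher passes the strict anchor test

Cell `ns-blowup`, seat `ns-blowup-ecbridge-3` (g3); GROUP C «BRIDGE SUPPORT» of the route
`PalasekTowerBreakdown` (crux `EpisodeBaseG`, item stmt-NavierStokesRegularity-19179, R2 of record).
LABEL: E–C typing (KERNEL, proofs only). WHAT THIS IS NOT: not Navier–Stokes evidence — a sufficient
condition, in terms of LOCAL properties of two prescribed compactly supported fields, for the strict
anchor test of the slot `LevelZeroData`; no explicit field is built here and nothing about NS dynamics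
is asserted.

## The abstract instance theorem

By `anchor_test_iff_fderiv3` (p450530) the strict anchor test of a symmetric composite design
`U = U₁ + U₂` at `x₀` is `−ν⟪U₁(x₀), ΔU₁(x₀)⟫ < ∫ D³Γ(x₀ − x)(U₂ x, U₂ x, U₁ x₀) dx`. If the even
carrier is moreover FLAT at its centre — `ΔU₁(x₀) = 0` (a fourth-order speed maximum, the «flat
symmetric top» of the cell's K-NOTE STATUS l.3225; its own NS acceleration then vanishes at `x₀`,
seat ecbridge-4's `accel_eq_zero_of_even_flat`) — the viscous braking term DISAPPEARS and the test is
the QUALITATIVE positivity of the integral. For a pusher `U₂` whose velocities are orthogonal to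
`e = U₁(x₀)` and whose support lies in the forward cone
`{x : ⟪x₀ − x, e⟫ < 0, 5⟨x₀ − x, d⟩² < ‖x₀ − x‖²‖d‖² for d = U₂ x ≠ 0}` at positive distance from `x₀`,
the integrand equals the CONTINUOUS compactly supported function
`⟪z, e⟫(15⟨z, U₂ x⟩² − 3‖z‖²‖U₂ x‖²)/(4π‖z‖⁷)`, `z = x₀ − x`, which is `≥ 0` everywhere and `> 0`
wherever `U₂ ≠ 0` (`fderiv3_newtonKernel_dde_pos`, p449691); hence (**`inner_accel_pos_of_flat_forward`**)
`⟪U(x₀), V(x₀)⟫ > 0` as soon as `U₂ ≢ 0`. What a KERNEL INSTANCE of `LevelZeroData` still owes is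
purely LOCAL: an explicit flat even divergence-free carrier with a strict unique speed maximum `Y₀`,
an explicit compactly supported horizontal pusher (speeds `< Y₀`) carrying the strain and core-loop
readouts, placed in the cone.

References: D. Gilbarg, N. S. Trudinger, *Elliptic PDE of Second Order* (2001), (2.13)
[cite: GilbargTrudinger2001, (2.13)]; A. J. Majda, A. L. Bertozzi, *Vorticity and Incompressible Flow*
(CUP 2002), §1.8 Prop. 1.16 [cite: MajdaBertozziCUP2002, §1.8 Prop. 1.16].
-/

noncomputable section

namespace Summit.NavierStokesRegularity.FluidComputer.PalasekTowerClayBridge.Germ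

open Set Function Filter Topology InnerProductSpace MeasureTheory Real
open scoped Topology ContDiff RealInnerProductSpace Laplacian

open Literature.Analysis.FluidPDE

-- nested operator types `ℝ³ →L[ℝ] ℝ³ →L[ℝ] ℝ` (second derivatives)
set_option maxSynthPendingDepth 3

/-! ## §1 The integrand of an orthogonal pusher as an explicit continuous function -/

/-- **The explicit integrand**: `pusherDensity x₀ e U₂ x = ⟪z, e⟫(15⟨z, U₂ x⟩² − 3‖z‖²‖U₂ x‖²)/(4π‖z‖⁷)`,
`z = x₀ − x`. [folklore] -/
def pusherDensity (x₀ e : EuclideanSpace ℝ (Fin 3)) (U₂ : EuclideanSpace ℝ (Fin 3) → EuclideanSpace ℝ (Fin 3))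
    (x : EuclideanSpace ℝ (Fin 3)) : ℝ :=
  ⟪x₀ - x, e⟫ * (15 * ⟪x₀ - x, U₂ x⟫ ^ 2 - 3 * ‖x₀ - x‖ ^ 2 * ‖U₂ x‖ ^ 2) /
    (4 * π * ‖x₀ - x‖ ^ 7)

section Pusher

variable {x₀ e : EuclideanSpace ℝ (Fin 3)} {U₂ : EuclideanSpace ℝ (Fin 3) → EuclideanSpace ℝ (Fin 3)}

/-- **For an orthogonal pusher away from `x₀` the `D³Γ` integrand IS the explicit density**, at every
point. [cite: GilbargTrudinger2001, (2.13)] -/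
theorem fderiv3_integrand_eq_pusherDensity (hperp : ∀ x, ⟪U₂ x, e⟫ = 0) (hx₀ : x₀ ∉ tsupport U₂)
    (x : EuclideanSpace ℝ (Fin 3)) :
    fderiv ℝ (fun w => fderiv ℝ (fun w' => fderiv ℝ newtonKernel w' (U₂ x)) w (U₂ x)) (x₀ - x) e =
      pusherDensity x₀ e U₂ x := by
  by_cases hz : x₀ - x = 0
  · have hx : x = x₀ := (sub_eq_zero.1 hz).symm
    have hU0 : U₂ x = 0 := by rw [hx]; exact image_eq_zero_of_notMem_tsupport hx₀
    simp [pusherDensity, hU0, hz]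
  · rw [pusherDensity, fderiv3_newtonKernel_dde hz (hperp x)]

/-- The explicit density vanishes near `x₀` (the pusher does). [folklore] -/
theorem pusherDensity_eventuallyEq_zero (hx₀ : x₀ ∉ tsupport U₂) :
    pusherDensity x₀ e U₂ =ᶠ[𝓝 x₀] fun _ => 0 := by
  filter_upwards [(isClosed_tsupport U₂).isOpen_compl.mem_nhds hx₀] with x hx
  simp [pusherDensity, image_eq_zero_of_notMem_tsupport hx]

/-- **The explicit density is continuous** (`U₂` continuous, vanishing near the singularity `x₀`).
[folklore] -/
theorem continuous_pusherDensity (hU₂ : Continuous U₂) (hx₀ : x₀ ∉ tsupport U₂) :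
    Continuous (pusherDensity x₀ e U₂) := by
  refine continuous_iff_continuousAt.2 fun x => ?_
  by_cases hx : x = x₀
  · subst hx
    exact (continuousAt_const.congr_of_eventuallyEq (pusherDensity_eventuallyEq_zero hx₀))
  · have hz : ∀ᶠ y in 𝓝 x, x₀ - y ≠ 0 := by
      filter_upwards [isOpen_ne.mem_nhds hx] with y hy
      exact sub_ne_zero.2 (Ne.symm hy)
    have hnum : Continuous fun y => ⟪x₀ - y, e⟫ *
        (15 * ⟪x₀ - y, U₂ y⟫ ^ 2 - 3 * ‖x₀ - y‖ ^ 2 * ‖U₂ y‖ ^ 2) := by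
      have hc : Continuous fun y : EuclideanSpace ℝ (Fin 3) => x₀ - y := continuous_const.sub continuous_id
      exact (hc.inner continuous_const).mul
        (((continuous_const.mul ((hc.inner hU₂).pow 2)).sub
          ((continuous_const.mul (hc.norm.pow 2)).mul (hU₂.norm.pow 2))))
    have hden : Continuous fun y : EuclideanSpace ℝ (Fin 3) => 4 * π * ‖x₀ - y‖ ^ 7 :=
      continuous_const.mul ((continuous_const.sub continuous_id).norm.pow 7)
    have hden0 : 4 * π * ‖x₀ - x‖ ^ 7 ≠ 0 := by
      have : ‖x₀ - x‖ ≠ 0 := norm_ne_zero_iff.2 (sub_ne_zero.2 (Ne.symm hx))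
      positivity
    exact (hnum.continuousAt.div hden.continuousAt hden0)

/-- The explicit density is supported inside `tsupport U₂`. [folklore] -/
theorem hasCompactSupport_pusherDensity (hU₂c : HasCompactSupport U₂) :
    HasCompactSupport (pusherDensity x₀ e U₂) :=
  hU₂c.mono' fun x hx => by
    apply subset_tsupport
    rw [mem_support] at hx ⊢
    intro h0
    exact hx (by simp [pusherDensity, h0])

/-- **Nonnegative in the forward cone**: if `⟪x₀ − x, e⟫ ≤ 0` and `5⟨x₀ − x, U₂ x⟩² ≤ ‖x₀ − x‖²‖U₂ x‖²`
then `pusherDensity x₀ e U₂ x ≥ 0`. [folklore] -/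
theorem pusherDensity_nonneg {x : EuclideanSpace ℝ (Fin 3)} (hfwd : ⟪x₀ - x, e⟫ ≤ 0)
    (hcone : 5 * ⟪x₀ - x, U₂ x⟫ ^ 2 ≤ ‖x₀ - x‖ ^ 2 * ‖U₂ x‖ ^ 2) :
    0 ≤ pusherDensity x₀ e U₂ x := by
  unfold pusherDensity
  have hnum : 0 ≤ ⟪x₀ - x, e⟫ * (15 * ⟪x₀ - x, U₂ x⟫ ^ 2 - 3 * ‖x₀ - x‖ ^ 2 * ‖U₂ x‖ ^ 2) :=
    mul_nonneg_of_nonpos_of_nonpos hfwd (by linarith)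
  positivity

/-- **Positive where the pusher is non-zero**, strictly inside the forward cone. [folklore] -/
theorem pusherDensity_pos {x : EuclideanSpace ℝ (Fin 3)} (hperp : ⟪U₂ x, e⟫ = 0)
    (hfwd : ⟪x₀ - x, e⟫ < 0) (hcone : 5 * ⟪x₀ - x, U₂ x⟫ ^ 2 < ‖x₀ - x‖ ^ 2 * ‖U₂ x‖ ^ 2) :
    0 < pusherDensity x₀ e U₂ x := by
  have hz : x₀ - x ≠ 0 := by
    intro h; rw [h, norm_zero] at hcone; nlinarith [sq_nonneg ⟪(0 : EuclideanSpace ℝ (Fin 3)), U₂ x⟫]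
  rw [pusherDensity, ← fderiv3_newtonKernel_dde hz hperp]
  exact fderiv3_newtonKernel_dde_pos hperp hfwd hcone

end Pusher

/-! ## §2 The abstract instance theorem -/

/-- **A FLAT SYMMETRIC CARRIER WITH A FORWARD-CONE ORTHOGONAL PUSHER PASSES THE STRICT ANCHOR TEST.**
Let `U₁, U₂ ∈ C_c^∞(ℝ³; ℝ³)` be divergence free with disjoint supports; `U₁` even about `x₀` and FLAT
there (`ΔU₁(x₀) = 0`); `U₂ ≢ 0` with velocities orthogonal to `e := U₁(x₀)`, supported at distance
`> r > 0` from `x₀` inside the closed forward cone (`⟪x₀ − x, e⟫ ≤ 0`,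
`5⟨x₀ − x, U₂ x⟩² ≤ ‖x₀ − x‖²‖U₂ x‖²` on `tsupport U₂`) and strictly inside it somewhere where
`U₂ ≠ 0`. Then `⟪U(x₀), V(x₀)⟫ > 0` for `U = U₁ + U₂`, `V = P(νΔU − (U·∇)U)`, at EVERY viscosity `ν`.
[cite: MajdaBertozziCUP2002, §1.8 Prop. 1.16] -/
theorem inner_accel_pos_of_flat_forward {ν : ℝ}
    {U₁ U₂ : EuclideanSpace ℝ (Fin 3) → EuclideanSpace ℝ (Fin 3)} {x₀ : EuclideanSpace ℝ (Fin 3)}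
    (h₁ : ContDiff ℝ ∞ U₁) (h₁c : HasCompactSupport U₁) (hdiv₁ : VectorCalculus.IsDivFree U₁)
    (he : IsEvenAbout x₀ U₁) (hflat : (Δ U₁) x₀ = 0)
    (h₂ : ContDiff ℝ ∞ U₂) (h₂c : HasCompactSupport U₂) (hdiv₂ : VectorCalculus.IsDivFree U₂)
    (hd : Disjoint (tsupport U₁) (tsupport U₂)) {r : ℝ} (hr : 0 < r)
    (hfar : ∀ x ∈ tsupport U₂, r < ‖x₀ - x‖)
    (hperp : ∀ x, ⟪U₂ x, U₁ x₀⟫ = 0)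
    (hfwd : ∀ x ∈ tsupport U₂, ⟪x₀ - x, U₁ x₀⟫ ≤ 0)
    (hcone : ∀ x ∈ tsupport U₂, 5 * ⟪x₀ - x, U₂ x⟫ ^ 2 ≤ ‖x₀ - x‖ ^ 2 * ‖U₂ x‖ ^ 2)
    {x₁ : EuclideanSpace ℝ (Fin 3)} (hfwd₁ : ⟪x₀ - x₁, U₁ x₀⟫ < 0)
    (hcone₁ : 5 * ⟪x₀ - x₁, U₂ x₁⟫ ^ 2 < ‖x₀ - x₁‖ ^ 2 * ‖U₂ x₁‖ ^ 2) :
    0 < ⟪(U₁ + U₂) x₀, accel ν (U₁ + U₂) x₀⟫ := by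
  have hx₀ : x₀ ∉ tsupport U₂ := fun h => by
    have := hfar x₀ h
    rw [sub_self, norm_zero] at this
    exact absurd this (not_lt.2 hr.le)
  rw [anchor_test_iff_fderiv3 h₁ h₁c hdiv₁ he h₂ h₂c hdiv₂ hd hr hfar, hflat, inner_zero_right,
    mul_zero, neg_zero]
  -- the integrand is the explicit continuous compactly supported density, `≥ 0` and `> 0` at `x₁`
  have heq : (fun x => fderiv ℝ (fun w => fderiv ℝ (fun w' => fderiv ℝ newtonKernel w' (U₂ x)) w (U₂ x))
      (x₀ - x) (U₁ x₀)) = pusherDensity x₀ (U₁ x₀) U₂ :=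
    funext fun x => fderiv3_integrand_eq_pusherDensity hperp hx₀ x
  rw [heq]
  have hnonneg : 0 ≤ pusherDensity x₀ (U₁ x₀) U₂ := by
    intro x
    by_cases hx : x ∈ tsupport U₂
    · exact pusherDensity_nonneg (hfwd x hx) (hcone x hx)
    · simp [pusherDensity, image_eq_zero_of_notMem_tsupport hx]
  exact (continuous_pusherDensity h₂.continuous hx₀).integral_pos_of_hasCompactSupport_nonneg_nonzero
    (hasCompactSupport_pusherDensity h₂c) hnonneg
    (pusherDensity_pos (hperp x₁) hfwd₁ hcone₁).ne'

end Summit.NavierStokesRegularity.FluidComputer.PalasekTowerClayBridge.Germ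

end
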